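import Summits.Ventures.HodgeRepro2.T6A2Shadow

/-!
# T6A2ShadowS — the glue, surface side: the identification of the interface's surface shadow
`(HS, pull, intS)` with the A2 carrier's `H^{even}(S, ℚ)`, `f^*`, `∫_S`, and the `z`-fields of the lead's
`ShadowData` (`z_alg`, `z_proj` for every `u`)

Cell pub-hodge-repro2, Tier 6 (README §10), seat t6-p2 (A2 owner). Continues `T6A2Shadow.lean` (split for
the 400-line rule). Definition lane: the structure `IdentS`. `zOf_mem_algOf` = TIER4 (S1) `z ∈ Alg^{20}(B)`
(`z_mem_Alg` + the degree datum); `zOf_proj_even` / `zOf_proj` = TIER4 (A4.1.1) `∫_B z ∪ u = ∫_S f^*u`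
(`integral_z_mul` = Lemma A4.1.1(ii) on even `u`; on odd `u` both sides vanish by degree;
`DirectSum.sum_support_decompose` glues). No `sorry`; standard axioms.
§8(d): uses an L-value-free non-vanishing device: NO.
-/

namespace Summit.Ventures.HodgeRepro2.T6.A2Shadow

open Summit.Ventures.HodgeRepro2.T6 Summit.Ventures.HodgeRepro2.T6.A2Gysin

universe u

section identS

variable {𝒞 : CycleTheory.{u}} {σ : A2Situation 𝒞} {K : Type*} [Field K] [NumberField K]

/-- THE MODEL IDENTIFICATION DATA, part 3 — THE SURFACE SHADOW: the interface's `HS = H^*(S, ℂ)`, `pull = f^*`,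
`intS = ∫_S` against the A2 carrier's `H^{even}(S, ℚ)`, `f^*`, `∫_S`: `evS` embeds the even-degree ring of `S`
into `HS`, `f^*` commutes with the complexifications, `∫_S` restricts to the model's integral, `∫_S f^*(·)`
kills the odd degrees of `H^*(B)` (the degree of ∫_S), and the Gysin class `z` has degree 20. -/
structure IdentS (I : IdentB σ K) (hPD : 𝒞.PoincareDuality) (HS : Type*) [Ring HS] [Algebra ℂ HS]
    (pull : HBC K →ₐ[ℂ] HS) (intS : HS →ₗ[ℂ] ℂ) where
  /-- `H^{even}(S, ℚ) → H^*(S, ℂ)` -/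
  evS : 𝒞.H σ.S →+* HS
  /-- `f^*` commutes with complexification: `pull (extC (ev a)) = evS (f^* a)` -/
  pull_extC : ∀ a, pull (extC K (I.ev a)) = evS (𝒞.pull σ.f a)
  /-- `∫_S` restricts to the model's integral -/
  intS_evS : ∀ a, intS (evS a) = ((𝒞.integral σ.S a : ℚ) : ℂ)
  /-- `∫_S f^*u = 0` for `u` of odd degree -/
  intS_odd : ∀ j, ∀ u ∈ degB K (2 * j + 1), intS (pull (extC K u)) = 0
  /-- `z ∈ H^{20}(B, ℚ)` (the degree of `f_*`, `2 (dim B − dim S) = 20`) -/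
  z_deg : I.ev (σ.z hPD) ∈ degB K 20

namespace IdentS

variable {I : IdentB σ K} {hPD : 𝒞.PoincareDuality} {HS : Type*} [Ring HS] [Algebra ℂ HS]
  {pull : HBC K →ₐ[ℂ] HS} {intS : HS →ₗ[ℂ] ℂ} (S : IdentS I hPD HS pull intS)

include S

/-- `z ∈ Alg 10` (TIER4 (S1): `z ∈ Alg^{20}(B)`; from `z_mem_Alg` and the degree datum). -/
theorem zOf_mem_algOf (hF1 : 𝒞.FultonProperPushForward) (hR : 𝒞.FultonCycleClassRingHom) :
    I.zOf hPD ∈ I.algOf 10 :=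
  ⟨Submodule.subset_span ⟨_, σ.z_mem_Alg hPD hF1 hR, rfl⟩, S.z_deg⟩

/-- TIER4 (S1), the projection formula `∫_B z ∪ u = ∫_S f^*u`, on even-degree `u`
(`integral_z_mul` = Lemma A4.1.1(ii) for `f`, transported by `ev` / `ψ` / `evS`). -/
theorem zOf_proj_even (J : IdentBB I hPD) (hCap : 𝒞.BredonCapProduct) (hAug : 𝒞.AugmentationNatural)
    (j : ℕ) (u : HB K) (hu : u ∈ degB K (2 * j)) :
    ((J.intBOf (I.zOf hPD * u) : ℚ) : ℂ) = intS (pull (extC K u)) := by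
  have hu' : I.ev (J.ψ u) = u := J.ev_ψ_even j u hu
  have hmul : I.zOf hPD * u = I.ev (σ.z hPD * J.ψ u) := by rw [IdentB.zOf, map_mul, hu']
  have hR : intS (pull (extC K u)) = ((𝒞.integral σ.S (𝒞.pull σ.f (J.ψ u)) : ℚ) : ℂ) := by
    conv_lhs => rw [← hu']
    rw [S.pull_extC, S.intS_evS]
  rw [hmul, hR]
  simp only [IdentBB.intBOf, LinearMap.comp_apply, J.ψ_ev]
  rw [σ.integral_z_mul hPD hCap hAug]

/-- TIER4 (S1), the projection formula for EVERY `u` (`TransferShadow.z_proj`): on odd degrees both sides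
vanish (the degree of `z ∪ u` is odd; `intS_odd`), the rest is the decomposition into homogeneous parts. -/
theorem zOf_proj (J : IdentBB I hPD) (hCap : 𝒞.BredonCapProduct) (hAug : 𝒞.AugmentationNatural)
    (u : HB K) : ((J.intBOf (I.zOf hPD * u) : ℚ) : ℂ) = intS (pull (extC K u)) := by
  classical
  let L : HB K →+ ℂ :=
    (algebraMap ℚ ℂ).toAddMonoidHom.comp
      (J.intBOf.toAddMonoidHom.comp (LinearMap.mulLeft ℚ (I.zOf hPD)).toAddMonoidHom)
  let R : HB K →+ ℂ :=
    intS.toAddMonoidHom.comp ((pull : HBC K →+* HS).toAddMonoidHom.comp (extC K : HB K →+* HBC K).toAddMonoidHom)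
  have hcomp : ∀ (i : ℕ) (v : HB K), v ∈ degB K i → L v = R v := by
    intro i v hv
    rcases Nat.even_or_odd i with ⟨j, hj⟩ | ⟨j, hj⟩
    · have hv' : v ∈ degB K (2 * j) := by rw [hj] at hv; convert hv using 2; ring
      exact S.zOf_proj_even J hCap hAug j v hv'
    · rw [hj] at hv
      have hL : J.intBOf (I.zOf hPD * v) = 0 := by
        refine J.intBOf_deg (20 + (2 * j + 1)) (by omega) _ ?_
        exact SetLike.mul_mem_graded (A := fun i : ℕ => ⋀[ℚ]^i (H1 K)) S.z_deg hv
      show (algebraMap ℚ ℂ) (J.intBOf (I.zOf hPD * v)) = intS (pull (extC K v))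
      rw [hL, map_zero, S.intS_odd j v hv]
  have : L u = R u := by
    rw [← DirectSum.sum_support_decompose (fun i : ℕ => ⋀[ℚ]^i (H1 K)) u, map_sum, map_sum]
    exact Finset.sum_congr rfl fun i _ => hcomp i _ (SetLike.coe_mem _)
  exact this

end IdentS

end identS

end Summit.Ventures.HodgeRepro2.T6.A2Shadow
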